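import Summits.ResolutionOfSingularities.ResolutionOfSingularities.Theorems.PurelyInseparableDim4WildConesBridge
import HarnessLib
import HarnessLib.Audit.Tags

/-!
# The Milnor LETTER `μ` on frame states at `(p, q) = (2, 2)` — one-edge form for the F4-C assembly
# (bridge WildCones ↔ `PIDim4`, letter file; cell `res-dim4-pi`, asked by p-14 / p-6 SCOPE DYNAMICS R3)

[OURS · counted 0 · repackaging of `WildConesBridge.milnor_lt_of_edge`; nothing here is a statement
about resolution of singularities.]

The letter is `μ(s) := dim_K K⟦x⟧ ⧸ ⟨∂₁↑s.F, …, ∂₄↑s.F⟩` (Mathlib's `Module.finrank`, which is `0` on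
an infinite-dimensional quotient, so `μ` is a total function `State K → ℕ`; it is MEANINGFUL exactly at
Milnor-finite states, in particular at isolated `2`-fold states by `milnorFinite_of_isIsolated_two`).

* `milnor_lt_of_step0_two` — `IsIsolated 2 s.F → IsIsolated 2 s'.F → Step0 2 s s' → μ s' < μ s`
  (STATE-LEVEL, no chart data in the statement): the form the lex glue `(Φ_C, μ)` of p-6's
  SCOPE DYNAMICS R3 / p-14's reshape (3) consumes.
* `milnor_lt_of_stepRule_two` — the same along any permissible coordinate rule (isolated states only
  admit the point, `IsolatedScope.stepRule_iff_step0_of_isIsolated`).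
* `milnor_pos_of_isIsolated_two` — at an isolated `2`-fold state `0 < μ s` (the quotient is finite
  and non-trivial), so on a NON-isolated → isolated edge the letter can only «rise» into positive
  values from the junk value `0`; the glue must let `Φ_C` pay there (p-14 (3)).

bears_on: LADDER-RESOLUTION:D157-DOOR2 (res-dim4-pi · F4-C assembly input). Supports
stmt-ResolutionOfSingularities-16155 (helper).
-/

set_option linter.dupNamespace false

noncomputable section

namespace Summit.ResolutionOfSingularities.ResolutionOfSingularities.Theorems.PIDim4

namespace WildConesBridge

open MvPolynomial IsLocalRing
open Literature.AlgebraicGeometry.Resolution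

variable {K : Type} [Field K]

/-- **The Milnor letter drops on every `Step0` edge between isolated `2`-fold states** (state-level
form of `milnor_lt_of_edge`). [cite: GreuelPfister2026, Thm 3.5 and Cor 3.7] -/
theorem milnor_lt_of_step0_two [CharP K 2] [DecidableEq K] {s s' : State K}
    (hs : IsIsolated 2 s.F) (hs' : IsIsolated 2 s'.F) (h : Step0 2 s s') :
    Module.finrank K (MvPowerSeries (Fin 4) K ⧸ Ideal.span (Set.range fun t : Fin 4 =>
        MvPowerSeries.pderiv t ((s'.F : MvPolynomial (Fin 4) K) : MvPowerSeries (Fin 4) K))) <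
      Module.finrank K (MvPowerSeries (Fin 4) K ⧸ Ideal.span (Set.range fun t : Fin 4 =>
        MvPowerSeries.pderiv t ((s.F : MvPolynomial (Fin 4) K) : MvPowerSeries (Fin 4) K))) := by
  obtain ⟨h2, j, b, -, hb, heq, -, hss'⟩ := h
  have hfin := milnorFinite_of_isIsolated_two hs
  have hfin' := milnorFinite_of_isIsolated_two hs'
  rw [hss'] at hfin' ⊢
  exact milnor_lt_of_edge hb h2 heq hfin hfin'

/-- The same along the steps of ANY permissible coordinate rule (at isolated states every permissible
rule takes the point). [folklore] -/
theorem milnor_lt_of_stepRule_two [CharP K 2] [DecidableEq K] (R : CentreRule K)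
    (hR : IsPermissibleRule 2 R) {s s' : State K}
    (hs : IsIsolated 2 s.F) (hs' : IsIsolated 2 s'.F) (h : StepRule 2 R s s') :
    Module.finrank K (MvPowerSeries (Fin 4) K ⧸ Ideal.span (Set.range fun t : Fin 4 =>
        MvPowerSeries.pderiv t ((s'.F : MvPolynomial (Fin 4) K) : MvPowerSeries (Fin 4) K))) <
      Module.finrank K (MvPowerSeries (Fin 4) K ⧸ Ideal.span (Set.range fun t : Fin 4 =>
        MvPowerSeries.pderiv t ((s.F : MvPolynomial (Fin 4) K) : MvPowerSeries (Fin 4) K))) :=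
  milnor_lt_of_step0_two hs hs' ((IsolatedScope.stepRule_iff_step0_of_isIsolated R hR hs).mp h)

/-- The formal Jacobian ideal of a polynomial with a `2`-fold origin is a PROPER ideal of `K⟦x⟧`
(it lies in the maximal ideal: `∂ᵢ` of a series of order `≥ 2` has order `≥ 1`). [folklore] -/
theorem span_pderiv_coe_le_maximalIdeal {F : MvPolynomial (Fin 4) K}
    (hJ : singLocusIdeal 2 F ≤ originIdeal K) :
    Ideal.span (Set.range fun t : Fin 4 =>
        MvPowerSeries.pderiv t ((F : MvPolynomial (Fin 4) K) : MvPowerSeries (Fin 4) K)) ≤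
      maximalIdeal (MvPowerSeries (Fin 4) K) := by
  rw [span_pderiv_coe_eq_map_singLocusIdeal, ← map_originIdeal_coe]
  exact Ideal.map_mono hJ

/-- **At an isolated `2`-fold state the Milnor letter is POSITIVE** (finite, and the Milnor algebra is a
non-zero ring because the Jacobian ideal is proper). [folklore] -/
theorem milnor_pos_of_isIsolated_two {F : MvPolynomial (Fin 4) K} (hiso : IsIsolated 2 F) :
    0 < Module.finrank K (MvPowerSeries (Fin 4) K ⧸ Ideal.span (Set.range fun t : Fin 4 =>
        MvPowerSeries.pderiv t ((F : MvPolynomial (Fin 4) K) : MvPowerSeries (Fin 4) K))) := by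
  haveI := milnorFinite_of_isIsolated_two hiso
  have hne : Ideal.span (Set.range fun t : Fin 4 =>
      MvPowerSeries.pderiv t ((F : MvPolynomial (Fin 4) K) : MvPowerSeries (Fin 4) K)) ≠ ⊤ :=
    fun h => (maximalIdeal.isMaximal (MvPowerSeries (Fin 4) K)).ne_top
      (top_le_iff.mp (h ▸ span_pderiv_coe_le_maximalIdeal hiso.1))
  haveI : Nontrivial (MvPowerSeries (Fin 4) K ⧸ Ideal.span (Set.range fun t : Fin 4 =>
      MvPowerSeries.pderiv t ((F : MvPolynomial (Fin 4) K) : MvPowerSeries (Fin 4) K))) :=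
    Ideal.Quotient.nontrivial_iff.mpr hne
  exact Module.finrank_pos

end WildConesBridge

end Summit.ResolutionOfSingularities.ResolutionOfSingularities.Theorems.PIDim4

end
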